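import Summits.QuantumAdvantage.AdviceFreeQNC0.SparseAvoidanceLinear
import HarnessLib

/-!
# Cell qa-qnc0 (rung F-Q1, route RingFrame): level sets of a two-bit eliminator and the choice of scale (lemmas for the elimination fail profile)

Lemmas for `EliminationProfile.lean` (planner qa-qnc0-p1 gen 12, ROUND-11 §1.4, ask P16), all
elementary and definition-free:

* the level-set partition of `EliminationHardness.lean` made PUBLIC (`ElimProfile.levelInd_mem_lowDeg`,
  `levelInd_ne_zero_iff`, `sum_card_levelSets`): the four sets `{a = α, b = β}` of a pair of degree-`≤ D`
  `𝔽₂`-polynomials have degree-`≤ 2D` indicators `(a + α + 1)(b + β + 1)` and partition the cube;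
* the THRESHOLD-FREE TRANSFER `ElimProfile.lt_card_fail_of_avoid`: if every `g` of degree `≤ 2D` whose
  support meets some class `{|u| ≡ r (3)}` in `≤ θ` points has `#supp g ≤ 2ⁿ/5`, then every eliminator
  `(a, b, dec)` of degree `≤ D` names the true residue on MORE than `θ` inputs;
* the SCALE `ElimProfile.exists_scale`: for `B√n ≥ 401`, `802·D ≤ A·n` an integer `L` with
  `400 ≤ L ≤ B√n`, `2D ≤ A·n/L`, `n/L² ≤ 4/B² + 16D²/(A²n)`;
* `ElimProfile.exp_half_lt_two : e^{1/2} < 2`.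

WHAT THIS IS NOT: no statement about strategies or circuits; bookkeeping only; crux α untouched.
-/

noncomputable section

namespace Summit.QuantumAdvantage.AdviceFreeQNC0

open Finset
open Literature.Computability.MetaComplexity Literature.Computability.MetaComplexity.Smolensky
open Literature.Computability.MetaComplexity.Hegedus

namespace ElimProfile

variable {n : ℕ}


/-! ### Level sets of a pair of `𝔽₂`-polynomials (as in `EliminationHardness.lean`, now public) -/

/-- Over `𝔽₂`: `x + α + 1 ≠ 0 ↔ x = α`. [folklore] -/
theorem zmod2_add_add_one_ne_zero_iff (x α : ZMod 2) : x + α + 1 ≠ 0 ↔ x = α := by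
  revert x α; decide

/-- The indicator `(a + α + 1)(b + β + 1)` of the level set `{a = α, b = β}` has degree `≤ d + d`.
[folklore] -/
theorem levelInd_mem_lowDeg {d : ℕ} {a b : CubeFn (ZMod 2) n}
    (ha : a ∈ lowDeg (ZMod 2) n d) (hb : b ∈ lowDeg (ZMod 2) n d) (α β : ZMod 2) :
    (a + (fun _ => α + 1)) * (b + (fun _ => β + 1)) ∈ lowDeg (ZMod 2) n (d + d) := by
  have hconst : ∀ c : ZMod 2, (fun _ : Fin n → Bool => c) ∈ lowDeg (ZMod 2) n d := by
    intro c
    have h1 : (1 : CubeFn (ZMod 2) n) ∈ lowDeg (ZMod 2) n d := by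
      rw [← mono_empty]
      exact mono_mem_lowDeg (by simp)
    have : (fun _ : Fin n → Bool => c) = c • (1 : CubeFn (ZMod 2) n) := by
      funext u; simp
    rw [this]
    exact Submodule.smul_mem _ c h1
  exact mul_mem_lowDeg_add (Submodule.add_mem _ ha (hconst _)) (Submodule.add_mem _ hb (hconst _))

/-- The support of the indicator is the level set. [folklore] -/
theorem levelInd_ne_zero_iff (a b : CubeFn (ZMod 2) n) (α β : ZMod 2) (u : Fin n → Bool) :
    ((a + (fun _ => α + 1)) * (b + (fun _ => β + 1)) : CubeFn (ZMod 2) n) u ≠ 0 ↔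
      a u = α ∧ b u = β := by
  simp only [Pi.mul_apply, Pi.add_apply, mul_ne_zero_iff]
  rw [← add_assoc, ← add_assoc, zmod2_add_add_one_ne_zero_iff, zmod2_add_add_one_ne_zero_iff]

/-- The four level sets partition the cube: `Σ_{α,β} #{a = α, b = β} = 2ⁿ`. [folklore] -/
theorem sum_card_levelSets (a b : CubeFn (ZMod 2) n) :
    ∑ p ∈ (univ : Finset (ZMod 2 × ZMod 2)),
      (univ.filter fun u : Fin n → Bool => a u = p.1 ∧ b u = p.2).card = 2 ^ n := by
  have h := card_eq_sum_card_fiberwise (s := (univ : Finset (Fin n → Bool)))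
    (t := (univ : Finset (ZMod 2 × ZMod 2))) (f := fun u => (a u, b u)) (fun _ _ => mem_univ _)
  have hU : (univ : Finset (Fin n → Bool)).card = 2 ^ n := by simp
  rw [← hU, h]
  refine sum_congr rfl fun p _ => ?_
  congr 1
  ext u
  simp [Prod.ext_iff]

/-- **The level-set transfer.**  If every `g` of degree `≤ D + D` whose support meets some residue
class in `≤ θ` points has `#supp g ≤ 2ⁿ/5`, then every eliminator `(a, b, dec)` of degree `≤ D`
names the true residue (= fails) on MORE than `θ` inputs (otherwise the four level sets, each
`2ⁿ/5`-small, could not cover the cube).  The cell's argument (`elimSqrtDec_of_lowDegAvoidMod3Sparse`),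
threshold-free form. [folklore] -/
theorem lt_card_fail_of_avoid {D : ℕ} {θ : ℝ}
    (H : ∀ r : ℕ, ∀ g : CubeFn (ZMod 2) n, g ∈ lowDeg (ZMod 2) n (D + D) →
      ((univ.filter fun u : Fin n → Bool => g u ≠ 0 ∧ wt u % 3 = r % 3).card : ℝ) ≤ θ →
      ((univ.filter fun u : Fin n → Bool => g u ≠ 0).card : ℝ) ≤ 1 / 5 * (2 : ℝ) ^ n)
    (a b : CubeFn (ZMod 2) n) (ha : a ∈ lowDeg (ZMod 2) n D) (hb : b ∈ lowDeg (ZMod 2) n D)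
    (dec : ZMod 2 → ZMod 2 → ℕ) :
    θ < ((univ.filter fun u : Fin n → Bool => dec (a u) (b u) % 3 = wt u % 3).card : ℝ) := by
  classical
  by_contra hle
  rw [not_lt] at hle
  -- every level set is `1/5`-sparse
  have key : ∀ α β : ZMod 2,
      ((univ.filter fun u : Fin n → Bool => a u = α ∧ b u = β).card : ℝ) ≤ 1 / 5 * (2 : ℝ) ^ n := by
    intro α β
    set g : CubeFn (ZMod 2) n := (a + (fun _ => α + 1)) * (b + (fun _ => β + 1)) with hg
    have hgd : g ∈ lowDeg (ZMod 2) n (D + D) := levelInd_mem_lowDeg ha hb α β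
    have hsupp : (univ.filter fun u : Fin n → Bool => g u ≠ 0) =
        univ.filter fun u : Fin n → Bool => a u = α ∧ b u = β :=
      filter_congr fun u _ => levelInd_ne_zero_iff a b α β u
    have hclass : ((univ.filter fun u : Fin n → Bool => g u ≠ 0 ∧ wt u % 3 = dec α β % 3).card : ℝ)
        ≤ θ := by
      have hsub : (univ.filter fun u : Fin n → Bool => g u ≠ 0 ∧ wt u % 3 = dec α β % 3) ⊆
          univ.filter fun u : Fin n → Bool => dec (a u) (b u) % 3 = wt u % 3 := by
        intro u hu
        rw [mem_filter] at hu ⊢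
        obtain ⟨hau, hbu⟩ := (levelInd_ne_zero_iff a b α β u).1 hu.2.1
        refine ⟨hu.1, ?_⟩
        rw [hau, hbu]
        exact hu.2.2.symm
      have h1 := card_le_card hsub
      have h2 : ((univ.filter fun u : Fin n → Bool => g u ≠ 0 ∧ wt u % 3 = dec α β % 3).card : ℝ) ≤
          ((univ.filter fun u : Fin n → Bool => dec (a u) (b u) % 3 = wt u % 3).card : ℝ) := by
        exact_mod_cast h1
      exact h2.trans hle
    have hres := H (dec α β) g hgd hclass
    rwa [hsupp] at hres
  -- but the four level sets cover the cube
  have hsumR : ∑ p ∈ (univ : Finset (ZMod 2 × ZMod 2)),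
      ((univ.filter fun u : Fin n → Bool => a u = p.1 ∧ b u = p.2).card : ℝ) = (2 : ℝ) ^ n := by
    exact_mod_cast sum_card_levelSets a b
  have hle4 : ∑ p ∈ (univ : Finset (ZMod 2 × ZMod 2)),
      ((univ.filter fun u : Fin n → Bool => a u = p.1 ∧ b u = p.2).card : ℝ) ≤
        ∑ _p ∈ (univ : Finset (ZMod 2 × ZMod 2)), 1 / 5 * (2 : ℝ) ^ n :=
    sum_le_sum fun p _ => key p.1 p.2
  rw [sum_const, card_univ] at hle4
  have hcard : Fintype.card (ZMod 2 × ZMod 2) = 4 := by simp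
  rw [hcard, hsumR] at hle4
  have hpos : (0 : ℝ) < (2 : ℝ) ^ n := by positivity
  norm_num at hle4
  linarith

/-! ### The choice of scale -/

/-- **The scale.**  For `B√n ≥ 401` and `802·D ≤ A·n` there is an integer scale `L` with `400 ≤ L ≤ B√n`,
`2D ≤ A·n/L` and `n/L² ≤ 4/B² + 16D²/(A²n)` (`L = ⌊B√n⌋` or `L = ⌊A·n/(2D)⌋`, whichever binds).
[folklore] -/
theorem exists_scale {A B : ℝ} (hA : 0 < A) (hB : 0 < B) {n D : ℕ}
    (hnB : (401 : ℝ) ≤ B * Real.sqrt n) (hnD : 802 * (D : ℝ) ≤ A * n) :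
    ∃ L : ℕ, 400 ≤ L ∧ (L : ℝ) ≤ B * Real.sqrt n ∧ ((D + D : ℕ) : ℝ) ≤ A * n / L ∧
      (n : ℝ) / (L : ℝ) ^ 2 ≤ 4 / B ^ 2 + 16 * (D : ℝ) ^ 2 / (A ^ 2 * n) := by
  have hnR0 : (0 : ℝ) ≤ n := Nat.cast_nonneg _
  have hsq : Real.sqrt n ^ 2 = n := Real.sq_sqrt hnR0
  have hBs0 : 0 ≤ B * Real.sqrt n := by positivity
  have hDR0 : (0 : ℝ) ≤ D := Nat.cast_nonneg _
  have hterm2 : 0 ≤ 16 * (D : ℝ) ^ 2 / (A ^ 2 * n) := by positivity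
  have hterm1 : 0 ≤ 4 / B ^ 2 := by positivity
  by_cases hcase : D = 0 ∨ B * Real.sqrt n ≤ A * n / (2 * D)
  · /- `L = ⌊B√n⌋` -/
    refine ⟨⌊B * Real.sqrt n⌋₊, ?_, Nat.floor_le hBs0, ?_, ?_⟩
    · exact Nat.le_floor (by push_cast; linarith)
    · have hLpos : (0 : ℝ) < (⌊B * Real.sqrt n⌋₊ : ℕ) := by
        have : (400 : ℕ) ≤ ⌊B * Real.sqrt n⌋₊ := Nat.le_floor (by push_cast; linarith)
        exact_mod_cast (show 0 < ⌊B * Real.sqrt n⌋₊ by omega)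
      rcases hcase with hD0 | hle
      · subst hD0
        simp only [add_zero, Nat.cast_zero]
        positivity
      · have hDpos : (0 : ℝ) < D := by
          rcases Nat.eq_zero_or_pos D with h | h
          · subst h
            simp only [Nat.cast_zero, mul_zero, div_zero] at hle
            linarith
          · exact_mod_cast h
        rw [le_div_iff₀ hLpos]
        have h1 : ((⌊B * Real.sqrt n⌋₊ : ℕ) : ℝ) ≤ A * n / (2 * D) := (Nat.floor_le hBs0).trans hle
        rw [le_div_iff₀ (by positivity)] at h1
        push_cast
        linarith
    · -- `L ≥ B√n − 1 ≥ B√n/2`, so `n/L² ≤ 4/B²`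
      have hL1 : B * Real.sqrt n - 1 ≤ (⌊B * Real.sqrt n⌋₊ : ℕ) := by
        have := Nat.lt_floor_add_one (B * Real.sqrt n)
        linarith
      have hLhalf : B * Real.sqrt n / 2 ≤ (⌊B * Real.sqrt n⌋₊ : ℕ) := by linarith
      have hLpos : (0 : ℝ) < (⌊B * Real.sqrt n⌋₊ : ℕ) := by linarith
      have hL2 : B ^ 2 * n / 4 ≤ ((⌊B * Real.sqrt n⌋₊ : ℕ) : ℝ) ^ 2 := by
        have h1 : (B * Real.sqrt n / 2) ^ 2 ≤ ((⌊B * Real.sqrt n⌋₊ : ℕ) : ℝ) ^ 2 :=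
          pow_le_pow_left₀ (by positivity) hLhalf 2
        calc B ^ 2 * n / 4 = (B * Real.sqrt n / 2) ^ 2 := by rw [div_pow, mul_pow, hsq]; ring
          _ ≤ _ := h1
      have h3 : (n : ℝ) / ((⌊B * Real.sqrt n⌋₊ : ℕ) : ℝ) ^ 2 ≤ 4 / B ^ 2 := by
        rw [div_le_div_iff₀ (by positivity) (by positivity)]
        nlinarith only [hL2]
      linarith
  · /- `L = ⌊A·n/(2D)⌋`, `D ≥ 1`, `A·n/(2D) < B√n` -/
    rw [not_or, not_le] at hcase
    obtain ⟨hD0, hlt⟩ := hcase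
    have hDpos : (0 : ℝ) < D := by exact_mod_cast Nat.pos_of_ne_zero hD0
    have h2D : (0 : ℝ) < 2 * D := by positivity
    have hX0 : 0 ≤ A * n / (2 * D) := by positivity
    have hX401 : (401 : ℝ) ≤ A * n / (2 * D) := by rw [le_div_iff₀ h2D]; linarith
    refine ⟨⌊A * n / (2 * D)⌋₊, ?_, ?_, ?_, ?_⟩
    · exact Nat.le_floor (by push_cast; linarith)
    · exact ((Nat.floor_le hX0).trans hlt.le)
    · have hLpos : (0 : ℝ) < (⌊A * n / (2 * D)⌋₊ : ℕ) := by
        have : (400 : ℕ) ≤ ⌊A * n / (2 * D)⌋₊ := Nat.le_floor (by push_cast; linarith)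
        exact_mod_cast (show 0 < ⌊A * n / (2 * D)⌋₊ by omega)
      rw [le_div_iff₀ hLpos]
      have h1 : ((⌊A * n / (2 * D)⌋₊ : ℕ) : ℝ) ≤ A * n / (2 * D) := Nat.floor_le hX0
      rw [le_div_iff₀ h2D] at h1
      push_cast
      linarith
    · -- `L ≥ A·n/(2D) − 1 ≥ A·n/(4D)`, so `n/L² ≤ 16D²/(A²n)`
      have hL1 : A * n / (2 * D) - 1 ≤ (⌊A * n / (2 * D)⌋₊ : ℕ) := by
        have := Nat.lt_floor_add_one (A * n / (2 * D))
        linarith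
      have hLq : A * n / (2 * D) / 2 ≤ (⌊A * n / (2 * D)⌋₊ : ℕ) := by linarith
      have hLpos : (0 : ℝ) < (⌊A * n / (2 * D)⌋₊ : ℕ) := by linarith
      have hnpos : (0 : ℝ) < n := by
        rcases Nat.eq_zero_or_pos n with h | h
        · subst h
          simp only [Nat.cast_zero, mul_zero, zero_div] at hX401
          linarith
        · exact_mod_cast h
      have hY : A * n / (2 * D) / 2 = A * n / (4 * D) := by
        rw [div_div]; ring_nf
      rw [hY] at hLq
      have hL2 : (A * n / (4 * D)) ^ 2 ≤ ((⌊A * n / (2 * D)⌋₊ : ℕ) : ℝ) ^ 2 :=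
        pow_le_pow_left₀ (by positivity) hLq 2
      have h3 : (n : ℝ) / ((⌊A * n / (2 * D)⌋₊ : ℕ) : ℝ) ^ 2 ≤ 16 * (D : ℝ) ^ 2 / (A ^ 2 * n) := by
        rw [div_le_div_iff₀ (by positivity) (by positivity)]
        have e : (A * n / (4 * D)) ^ 2 * (16 * (D : ℝ) ^ 2) = (n : ℝ) * (A ^ 2 * n) := by
          field_simp
          ring
        nlinarith only [hL2, e, hDpos, hnpos]
      linarith

/-- `e^{1/2} < 2` (since `e < 4`). [folklore] -/
theorem exp_half_lt_two : Real.exp (1 / 2) < 2 := by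
  have h : Real.exp (1 / 2) ^ 2 < 2 ^ 2 := by
    rw [← Real.exp_nat_mul]
    have e : ((2 : ℕ) : ℝ) * (1 / 2) = 1 := by norm_num
    rw [e]
    have := Real.exp_one_lt_d9
    norm_num at this ⊢
    linarith
  exact lt_of_pow_lt_pow_left₀ 2 (by norm_num) h

end ElimProfile

end Summit.QuantumAdvantage.AdviceFreeQNC0
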